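import Summits.HodgeConjecture.CorCM.Census.CyclicCharacterFibreWalk
import Summits.HodgeConjecture.CorCM.Census.TwoAdicSplittingTraceResidual

/-!
# Cyclic characters, XVI: THE ARC-SHIFT RELATIONS — an exact, group-free META theorem for the whole class

COR-CM (cell `pub-hodgecm2`), count-neutral kernel combinatorics by the binder seat b09 (gen 42; lane CYCLIC-CHARACTER FIBRE LAW, part XVI), on parts XII
(`Census/CyclicCharacterFlipOrbit.lean`) and XIV (`Census/CyclicCharacterFibreWalk.lean`) and b09/b23ʼs floor `φ₂ ≤ |S|` (`Coinvariant.fibreTwo_le_card_of_faces`)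
BY NAME.  Theorems only (no definition, no `decide`, no certificate, no named fact, no `sorry`).
HONEST FRAMING: `HC_CM` is NOT proved, here or anywhere in the tree; nothing here is a period or a headline.

THE ARC-SHIFT RELATION of a point `s ∈ T_0` at position `i = w s`:

  `Y(s) := [T_0^{(s)}] − [T_0] − [T_i^{(s)}] + [T_i]`  (`T_i = w⁻¹(i + arc)`, so that `s` sits at the BOTTOM of `T_i`)

— «the flip defect at the place of `s` is the same for the two arc types through `s`».  It is a Hodge vector (type sum `0`), it vanishes for bottom points,
and `T_i^{(s)}` lies in the flip orbit of `T_0^{(s₀)}` (`w s₀ = 0`).  Hence (§1) if `ℤ⟨pairs⟩ + ℤ[G]·S` contains `Y(s)` for every `s ∈ T_0`, the repaired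
hypothesis (flip′) of part XII holds WITH EXPONENT `0`; together with the fibre-sum relation (W2) of part XIV (exponent `0`) and gen 38ʼs integral cover,
part XIIʼs flip-orbit reduction theorem gives `hodgeSpan ≤ ℤ⟨pairs⟩ + ℤ[G]·S` OUTRIGHT — no power of `2`, no `2`-group hypothesis, no coboundary or parity
condition (§2, `hodgeSpan_le_psp_of_shift`).  With the floor `φ₂ ≤ |S|`:

**THE ARC-SHIFT META THEOREM (§3, `isLeast_card_gfaces_generate_of_shift`, ANY finite `G`, ANY `k ≥ 1`).**  A face family `S₀` with `|S₀| ≤ φ₂(G, c)` such that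
`ℤ⟨pairs⟩ + ℤ[G]·S₀` (cov) reduces every type integrally to potential `≤ 1`, (shift) contains the arc-shift relations `Y(s)`, `s ∈ T_0` (one per
position `1 ≤ i < 2ᵏ⁻¹` suffices up to `ker w`- and `G`-translation), and (fib) contains `Σ_{w s = 0} [T_0^{(s)}] − [T_1] − (|ker w| − 1)[T_0]`, has EXACTLY
`φ₂(G, c)` members and realises `μ(G, c) = φ₂(G, c)`.

§2 also proves the ARC-SHIFT LAW for Hodge-vector generators (`hodgeSpan_le_psp_cover_union`): for EVERY integral cover `S_c` of the arc block,
`hodgeSpan = ℤ⟨pairs⟩ + ℤ[G]·(S_c ∪ {Y(s)}_s ∪ {(W2)})` — so what a column of the class still owes for `μ = φ₂` is ONLY to realise the `2ᵏ⁻¹` vectors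
`Y(s_1), …, Y(s_{2ᵏ⁻¹−1}), (W2)` (one `s_i` per position) by `φ₂ − |cover|` faces.
NUMERICS (gen 42 `py/shiftcheck.py`, integral Hermite forms, one `s_i` per position): `ℤ⟨pairs⟩ + ℤ[G]·cover + ℤ[G]·{Y(s_i)}_i + ℤ[G]·(W2) = hodgeSpan`
with index `1` in every row computed — `k = 2`: `Dic₃`, `ℤ/12`, `ℤ/4 ⋊ ℤ/4` (both central `c`), `Q₈ ×_ε ℤ/4`, `Dic₅`, `ℤ/20`, `Dic₇` (`β = 586`, cover `583`);
`k = 3`: `ℤ/3 ⋊ ℤ/8` and `ℤ/24` (`β = 172`, `φ₂ = 171`: cover `167` + `3` shifts + (W2)), `ℤ/8 × ℤ/2`; `k = 4`: `ℤ/16` — and none of `Y(s_i)`, (W2) lies in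
`ℤ⟨pairs⟩ + ℤ[G]·cover` except where `d = 0` spares one (`ℤ/4 ⋊ ℤ/4`, `c = x²y²`: (W2) does; `ℤ/8 × ℤ/2`: (W2) ∈ the span of the shifts): the closing
content of a certificate is EXACTLY the `2ᵏ⁻¹ − 1` arc-shift relations plus the fibre-sum relation, `2ᵏ⁻¹ − 1 + d` faces.

## References
* [Pohlmann1968] H. Pohlmann, Algebraic cycles on abelian varieties of complex multiplication type, Ann. of Math. 88 (1968), Thm 1.
* [Milne1999] J. S. Milne, Lefschetz motives and the Tate conjecture, Compositio Math. 117 (1999), Prop. 2.1, p. 54.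
-/

namespace Summit.HodgeConjecture.CorCM.Census.CyclicCharacter

open Finset
open Summit.HodgeConjecture.CorCM.Prior.AllgGroup.RfwfAllgGroup
open Summit.HodgeConjecture.CorCM.Census.BlockParity
open Summit.HodgeConjecture.CorCM.Census.Coinvariant
open Summit.HodgeConjecture.CorCM.Census.TwistGeneration
open Summit.HodgeConjecture.CorCM.Census.BaseBlock
open Summit.HodgeConjecture.CorCM.Census.Splitting

noncomputable section

variable {G : Type*} [Group G] [Fintype G] [DecidableEq G] {k : ℕ} {w : G → ZMod (2 ^ k)} {c : G}

/-! ## §1 The arc through `s` with `s` at the bottom, and (flip′) from the arc-shift relations -/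

/-- **`T_{w s}^{(s)}` lies in the flip orbit of `T_0^{(s₀)}`** (`w s₀ = 0`): `T_{w s}^{(s)} = T_0^{(s₀)}·(s⁻¹s₀)⁻¹`. [folklore] -/
theorem oflipCM_arcType_apply_eq_rt (hw : ∀ P Q : G, w (P * Q) = w P + w Q) (hk : 1 ≤ k) (hc2 : c * c = 1) (hwc : w c ≠ 0)
    {s₀ : G} (hs₀ : w s₀ = 0) (s : G) :
    oflipCM c hc2 s (arcType hw hk hc2 hwc (w s)) = rt c (s⁻¹ * s₀) (oflipCM c hc2 s₀ (arcType hw hk hc2 hwc 0)) := by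
  rw [rt_oflipCM, rt_arcType, hw, map_inv hw, hs₀, add_zero, zero_sub, neg_neg, mul_inv_rev, inv_inv, mul_inv_cancel_left]

/-- **Arc-shift vectors along a fibre are base changes of one another**: `Y(s) = Y(s')·(s⁻¹s')⁻¹` when `w s = w s'`. [folklore] -/
theorem shift_eq_mapDomain_of_apply_eq (hw : ∀ P Q : G, w (P * Q) = w P + w Q) (hk : 1 ≤ k) (hc2 : c * c = 1) (hwc : w c ≠ 0)
    {s s' : G} (h : w s = w s') :
    Finsupp.single (oflipCM c hc2 s (arcType hw hk hc2 hwc 0)) (1 : ℤ) - Finsupp.single (arcType hw hk hc2 hwc 0) 1 -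
        Finsupp.single (oflipCM c hc2 s (arcType hw hk hc2 hwc (w s))) 1 + Finsupp.single (arcType hw hk hc2 hwc (w s)) 1 =
      Finsupp.mapDomain (rt c (s⁻¹ * s'))
        (Finsupp.single (oflipCM c hc2 s' (arcType hw hk hc2 hwc 0)) (1 : ℤ) - Finsupp.single (arcType hw hk hc2 hwc 0) 1 -
          Finsupp.single (oflipCM c hc2 s' (arcType hw hk hc2 hwc (w s'))) 1 + Finsupp.single (arcType hw hk hc2 hwc (w s')) 1) := by
  have hQ : w (s⁻¹ * s') = 0 := by rw [hw, map_inv hw, h, neg_add_cancel]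
  have e : s' * (s⁻¹ * s')⁻¹ = s := by rw [mul_inv_rev, inv_inv, mul_inv_cancel_left]
  simp only [Finsupp.mapDomain_add, Finsupp.mapDomain_sub, Finsupp.mapDomain_single, rt_oflipCM, rt_arcType, hQ, sub_zero, e, h]

/-- **One representative per fibre suffices for (shift)**: if `ℤ⟨pairs⟩ + ℤ[G]·S` contains `Y(s')` then it contains `Y(s)` for every `s` with `w s = w s'`
(central `c`). [folklore] -/
theorem shift_mem_psp_of_apply_eq (hw : ∀ P Q : G, w (P * Q) = w P + w Q) (hk : 1 ≤ k) (hc2 : c * c = 1) (hcen : ∀ x : G, x * c = c * x)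
    (hwc : w c ≠ 0) (S : Finset (CMF G c →₀ ℤ)) {s s' : G} (h : w s = w s')
    (hs' : Finsupp.single (oflipCM c hc2 s' (arcType hw hk hc2 hwc 0)) (1 : ℤ) - Finsupp.single (arcType hw hk hc2 hwc 0) 1 -
        Finsupp.single (oflipCM c hc2 s' (arcType hw hk hc2 hwc (w s'))) 1 + Finsupp.single (arcType hw hk hc2 hwc (w s')) 1 ∈
          Submodule.span ℤ (pairSet c) ⊔ Submodule.span ℤ (translates c S)) :
    Finsupp.single (oflipCM c hc2 s (arcType hw hk hc2 hwc 0)) (1 : ℤ) - Finsupp.single (arcType hw hk hc2 hwc 0) 1 -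
        Finsupp.single (oflipCM c hc2 s (arcType hw hk hc2 hwc (w s))) 1 + Finsupp.single (arcType hw hk hc2 hwc (w s)) 1 ∈
      Submodule.span ℤ (pairSet c) ⊔ Submodule.span ℤ (translates c S) := by
  rw [shift_eq_mapDomain_of_apply_eq hw hk hc2 hwc h]
  exact mapDomain_rt_mem_psp c hcen _ S hs'

/-- **(shift) from one representative per position**: if for every `s ∈ T_0` some `s'` in its fibre has `Y(s') ∈ ℤ⟨pairs⟩ + ℤ[G]·S`, then (shift) holds. [folklore] -/
theorem hshift_of_representatives (hw : ∀ P Q : G, w (P * Q) = w P + w Q) (hk : 1 ≤ k) (hc2 : c * c = 1) (hcen : ∀ x : G, x * c = c * x)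
    (hwc : w c ≠ 0) (S : Finset (CMF G c →₀ ℤ))
    (hrep : ∀ s ∈ (arcType hw hk hc2 hwc 0).1, ∃ s' : G, w s = w s' ∧
      Finsupp.single (oflipCM c hc2 s' (arcType hw hk hc2 hwc 0)) (1 : ℤ) - Finsupp.single (arcType hw hk hc2 hwc 0) 1 -
        Finsupp.single (oflipCM c hc2 s' (arcType hw hk hc2 hwc (w s'))) 1 + Finsupp.single (arcType hw hk hc2 hwc (w s')) 1 ∈
          Submodule.span ℤ (pairSet c) ⊔ Submodule.span ℤ (translates c S)) :
    ∀ s ∈ (arcType hw hk hc2 hwc 0).1,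
      Finsupp.single (oflipCM c hc2 s (arcType hw hk hc2 hwc 0)) (1 : ℤ) - Finsupp.single (arcType hw hk hc2 hwc 0) 1 -
        Finsupp.single (oflipCM c hc2 s (arcType hw hk hc2 hwc (w s))) 1 + Finsupp.single (arcType hw hk hc2 hwc (w s)) 1 ∈
          Submodule.span ℤ (pairSet c) ⊔ Submodule.span ℤ (translates c S) := by
  intro s hs
  obtain ⟨s', h, hs'⟩ := hrep s hs
  exact shift_mem_psp_of_apply_eq hw hk hc2 hcen hwc S h hs'

/-- **Bottom points need nothing**: `Y(s) = 0` when `w s = 0`. [folklore] -/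
theorem shift_eq_zero_of_apply_eq_zero (hw : ∀ P Q : G, w (P * Q) = w P + w Q) (hk : 1 ≤ k) (hc2 : c * c = 1) (hwc : w c ≠ 0)
    {s : G} (hs : w s = 0) :
    Finsupp.single (oflipCM c hc2 s (arcType hw hk hc2 hwc 0)) (1 : ℤ) - Finsupp.single (arcType hw hk hc2 hwc 0) 1 -
        Finsupp.single (oflipCM c hc2 s (arcType hw hk hc2 hwc (w s))) 1 + Finsupp.single (arcType hw hk hc2 hwc (w s)) 1 = 0 := by
  rw [hs]; abel

/-- **(flip′) WITH EXPONENT `0` FROM THE ARC-SHIFT RELATIONS**: if `ℤ⟨pairs⟩ + ℤ[G]·S` contains `Y(s) = [T_0^{(s)}] − [T_0] − [T_{w s}^{(s)}] + [T_{w s}]`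
for every `s ∈ T_0`, then every single flip of `T_0` lies in the repaired target (flip orbit of `T_0^{(s₀)}`, `w s₀ = 0`). [folklore] -/
theorem hflip_of_shift (hw : ∀ P Q : G, w (P * Q) = w P + w Q) (hk : 1 ≤ k) (hc2 : c * c = 1) (hwc : w c ≠ 0) (h1 : ∃ g₁ : G, w g₁ = 1)
    (S : Finset (CMF G c →₀ ℤ)) {s₀ : G} (hs₀ : w s₀ = 0)
    (hshift : ∀ s ∈ (arcType hw hk hc2 hwc 0).1,
      Finsupp.single (oflipCM c hc2 s (arcType hw hk hc2 hwc 0)) (1 : ℤ) - Finsupp.single (arcType hw hk hc2 hwc 0) 1 -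
        Finsupp.single (oflipCM c hc2 s (arcType hw hk hc2 hwc (w s))) 1 + Finsupp.single (arcType hw hk hc2 hwc (w s)) 1 ∈
          Submodule.span ℤ (pairSet c) ⊔ Submodule.span ℤ (translates c S)) :
    ∀ s ∈ (arcType hw hk hc2 hwc 0).1, ((2 : ℤ) ^ 0) • Finsupp.single (oflipCM c hc2 s (arcType hw hk hc2 hwc 0)) (1 : ℤ) ∈
      ((Submodule.span ℤ (pairSet c) ⊔ Submodule.span ℤ (translates c S)) ⊔
        Submodule.span ℤ (Set.range fun Q : G => Finsupp.single (rt c Q (arcType hw hk hc2 hwc 0)) (1 : ℤ))) ⊔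
          Submodule.span ℤ (Set.range fun Q : G => Finsupp.single (rt c Q (oflipCM c hc2 s₀ (arcType hw hk hc2 hwc 0))) (1 : ℤ)) := by
  intro s hs
  rw [pow_zero, one_smul]
  have e : Finsupp.single (oflipCM c hc2 s (arcType hw hk hc2 hwc 0)) (1 : ℤ) =
      (Finsupp.single (oflipCM c hc2 s (arcType hw hk hc2 hwc 0)) (1 : ℤ) - Finsupp.single (arcType hw hk hc2 hwc 0) 1 -
        Finsupp.single (oflipCM c hc2 s (arcType hw hk hc2 hwc (w s))) 1 + Finsupp.single (arcType hw hk hc2 hwc (w s)) 1) +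
      (Finsupp.single (arcType hw hk hc2 hwc 0) 1 - Finsupp.single (arcType hw hk hc2 hwc (w s)) 1) +
        Finsupp.single (oflipCM c hc2 s (arcType hw hk hc2 hwc (w s))) 1 := by abel
  rw [e]
  obtain ⟨Q, hQ⟩ := exists_apply_eq hw h1 (-w s)
  refine Submodule.add_mem _ (Submodule.add_mem _ (Submodule.mem_sup_left (Submodule.mem_sup_left (hshift s hs)))
    (Submodule.mem_sup_left (Submodule.mem_sup_right (Submodule.sub_mem _ (single_mem_span_range_rt _) ?_)))) ?_
  · rw [arcType_eq_rt hw hk hc2 hwc hQ]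
    exact Submodule.subset_span ⟨Q, rfl⟩
  · rw [oflipCM_arcType_apply_eq_rt hw hk hc2 hwc hs₀]
    exact Submodule.mem_sup_right (Submodule.subset_span ⟨s⁻¹ * s₀, rfl⟩)

/-! ## §2 Generation outright -/

/-- **GENERATION FROM A COVER, THE ARC-SHIFT RELATIONS AND THE FIBRE-SUM RELATION** (any finite `G`, `w` onto, `c` central): if `S ⊆ hodgeSpan` and
`ℤ⟨pairs⟩ + ℤ[G]·S` (cov) reduces every type integrally to potential `≤ 1`, (shift) contains every `Y(s)`, `s ∈ T_0`, and (fib) contains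
`Σ_{w s = 0} [T_0^{(s)}] − [T_1] − (|ker w| − 1)·[T_0]`, then **`hodgeSpan ≤ ℤ⟨pairs⟩ + ℤ[G]·S`**. [folklore] -/
theorem hodgeSpan_le_psp_of_shift [Fintype (CMF G c)] (hw : ∀ P Q : G, w (P * Q) = w P + w Q) (hk : 1 ≤ k) (hc2 : c * c = 1)
    (hcen : ∀ x : G, x * c = c * x) (hwc : w c ≠ 0) (h1 : ∃ g₁ : G, w g₁ = 1) (S : Finset (CMF G c →₀ ℤ))
    (hS : (↑S : Set (CMF G c →₀ ℤ)) ⊆ hodgeSpan c hc2)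
    (hcov : ∀ Φ : CMF G c, Finsupp.single Φ (1 : ℤ) ∈
      (Submodule.span ℤ (pairSet c) ⊔ Submodule.span ℤ (translates c S)) ⊔
        Submodule.span ℤ ((fun Ψ => Finsupp.single Ψ (1 : ℤ)) '' {Ψ : CMF G c | bpot c (arcType hw hk hc2 hwc 0) Ψ ≤ 1}))
    (hshift : ∀ s ∈ (arcType hw hk hc2 hwc 0).1,
      Finsupp.single (oflipCM c hc2 s (arcType hw hk hc2 hwc 0)) (1 : ℤ) - Finsupp.single (arcType hw hk hc2 hwc 0) 1 -
        Finsupp.single (oflipCM c hc2 s (arcType hw hk hc2 hwc (w s))) 1 + Finsupp.single (arcType hw hk hc2 hwc (w s)) 1 ∈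
          Submodule.span ℤ (pairSet c) ⊔ Submodule.span ℤ (translates c S))
    (hfib : (∑ s ∈ univ.filter (fun s => w s = 0), Finsupp.single (oflipCM c hc2 s (arcType hw hk hc2 hwc 0)) (1 : ℤ)) -
      Finsupp.single (arcType hw hk hc2 hwc 1) (1 : ℤ) -
        (((univ.filter fun s => w s = 0).card : ℤ) - 1) • Finsupp.single (arcType hw hk hc2 hwc 0) (1 : ℤ) ∈
          Submodule.span ℤ (pairSet c) ⊔ Submodule.span ℤ (translates c S)) :
    hodgeSpan c hc2 ≤ Submodule.span ℤ (pairSet c) ⊔ Submodule.span ℤ (translates c S) := by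
  intro y hy
  have h := two_pow_smul_mem_psp_of_single_flips' hw hk hc2 hcen hwc h1 (one_mem_arcType_zero hw hk hc2 hwc) S hS 0 0 hcov
    (hflip_of_shift hw hk hc2 hwc h1 S (map_one hw) hshift) (fibreSum_mem_of_rel hw hk hc2 hwc h1 _ hfib (map_one hw)) y hy
  rwa [add_zero, pow_zero, one_smul] at h

/-- **THE HODGE LATTICE OF THE CLASS IS GENERATED, MODULO PAIRS, BY ANY COVER OF THE ARC BLOCK, THE ARC-SHIFT VECTORS AND ONE FIBRE-SUM VECTOR**
(any finite `G`): if `S_c ⊆ hodgeSpan` reduces every type integrally to potential `≤ 1`, then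
`hodgeSpan = ℤ⟨pairs⟩ + ℤ[G]·(S_c ∪ {Y(s) : s ∈ T_0} ∪ {Σ_{w s = 0} [T_0^{(s)}] − [T_1] − (|ker w| − 1)[T_0]})` — the numerical ARC-SHIFT LAW of the header,
as a theorem for Hodge-vector generators (what a column still owes is to realise the `2ᵏ⁻¹` extra vectors by faces). [folklore] -/
theorem hodgeSpan_le_psp_cover_union [Fintype (CMF G c)] (hw : ∀ P Q : G, w (P * Q) = w P + w Q) (hk : 1 ≤ k) (hc2 : c * c = 1)
    (hcen : ∀ x : G, x * c = c * x) (hwc : w c ≠ 0) (h1 : ∃ g₁ : G, w g₁ = 1) (Sc : Finset (CMF G c →₀ ℤ))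
    (hSc : (↑Sc : Set (CMF G c →₀ ℤ)) ⊆ hodgeSpan c hc2)
    (hcov : ∀ Φ : CMF G c, Finsupp.single Φ (1 : ℤ) ∈
      (Submodule.span ℤ (pairSet c) ⊔ Submodule.span ℤ (translates c Sc)) ⊔
        Submodule.span ℤ ((fun Ψ => Finsupp.single Ψ (1 : ℤ)) '' {Ψ : CMF G c | bpot c (arcType hw hk hc2 hwc 0) Ψ ≤ 1})) :
    hodgeSpan c hc2 ≤ Submodule.span ℤ (pairSet c) ⊔ Submodule.span ℤ (translates c
      ((Sc ∪ (arcType hw hk hc2 hwc 0).1.image fun s =>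
        Finsupp.single (oflipCM c hc2 s (arcType hw hk hc2 hwc 0)) (1 : ℤ) - Finsupp.single (arcType hw hk hc2 hwc 0) 1 -
          Finsupp.single (oflipCM c hc2 s (arcType hw hk hc2 hwc (w s))) 1 + Finsupp.single (arcType hw hk hc2 hwc (w s)) 1) ∪
        {(∑ s ∈ univ.filter (fun s => w s = 0), Finsupp.single (oflipCM c hc2 s (arcType hw hk hc2 hwc 0)) (1 : ℤ)) -
          Finsupp.single (arcType hw hk hc2 hwc 1) (1 : ℤ) -
            (((univ.filter fun s => w s = 0).card : ℤ) - 1) • Finsupp.single (arcType hw hk hc2 hwc 0) (1 : ℤ)})) := by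
  have hc1 : c ≠ 1 := c_ne_one hw hwc
  set S := (Sc ∪ (arcType hw hk hc2 hwc 0).1.image fun s =>
        Finsupp.single (oflipCM c hc2 s (arcType hw hk hc2 hwc 0)) (1 : ℤ) - Finsupp.single (arcType hw hk hc2 hwc 0) 1 -
          Finsupp.single (oflipCM c hc2 s (arcType hw hk hc2 hwc (w s))) 1 + Finsupp.single (arcType hw hk hc2 hwc (w s)) 1) ∪
        {(∑ s ∈ univ.filter (fun s => w s = 0), Finsupp.single (oflipCM c hc2 s (arcType hw hk hc2 hwc 0)) (1 : ℤ)) -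
          Finsupp.single (arcType hw hk hc2 hwc 1) (1 : ℤ) -
            (((univ.filter fun s => w s = 0).card : ℤ) - 1) • Finsupp.single (arcType hw hk hc2 hwc 0) (1 : ℤ)} with hSdef
  have hsub : Sc ⊆ S := fun x hx => by rw [hSdef]; exact mem_union_left _ (mem_union_left _ hx)
  have hmono : Submodule.span ℤ (pairSet c) ⊔ Submodule.span ℤ (translates c Sc) ≤
      Submodule.span ℤ (pairSet c) ⊔ Submodule.span ℤ (translates c S) :=
    sup_le_sup_left (Submodule.span_mono fun y hy => by obtain ⟨Q, s, hs, e⟩ := hy; exact ⟨Q, s, hsub hs, e⟩) _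
  -- the new generators are Hodge vectors: arc-shift vectors have type sum 0, the fibre-sum vector by (W2) lies in the face span
  have hY : ∀ s ∈ (arcType hw hk hc2 hwc 0).1,
      Finsupp.single (oflipCM c hc2 s (arcType hw hk hc2 hwc 0)) (1 : ℤ) - Finsupp.single (arcType hw hk hc2 hwc 0) 1 -
        Finsupp.single (oflipCM c hc2 s (arcType hw hk hc2 hwc (w s))) 1 + Finsupp.single (arcType hw hk hc2 hwc (w s)) 1 ∈ hodgeSpan c hc2 := by
    intro s hs
    have hs' : s ∈ (arcType hw hk hc2 hwc (w s)).1 := by rw [mem_arcType, sub_self, ZMod.val_zero]; exact Nat.two_pow_pos _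
    refine mem_hodgeSpan_of_forall_typeSum_eq c hc2 hc1 hcen (k := 0) fun x => ?_
    simp only [map_add, map_sub, Pi.add_apply, Pi.sub_apply, typeSum_single]
    rw [indG_oflipCM_eq hc2 hc1 _ hs, indG_oflipCM_eq hc2 hc1 _ hs']
    ring
  have hR : (∑ s ∈ univ.filter (fun s => w s = 0), Finsupp.single (oflipCM c hc2 s (arcType hw hk hc2 hwc 0)) (1 : ℤ)) -
      Finsupp.single (arcType hw hk hc2 hwc 1) (1 : ℤ) -
        (((univ.filter fun s => w s = 0).card : ℤ) - 1) • Finsupp.single (arcType hw hk hc2 hwc 0) (1 : ℤ) ∈ hodgeSpan c hc2 := by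
    refine Submodule.mem_sup_left ((Submodule.span_mono ?_) (fibreSum_sub_mem_span_walkFaces hw hk hc2 hwc))
    rintro _ ⟨Φ', s, s', -, hs, hs', hss', rfl⟩
    refine ⟨Φ', s, s', ?_, rfl⟩
    rw [mem_orb]
    rintro (h | h)
    · exact hss' h.symm
    · exact ((arcType hw hk hc2 hwc 0).2 s).mp (mem_sdiff.mp hs).1 (h ▸ (mem_sdiff.mp hs').1)
  have hS : (↑S : Set (CMF G c →₀ ℤ)) ⊆ hodgeSpan c hc2 := by
    intro y hy
    rw [hSdef, coe_union, coe_union] at hy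
    rcases hy with (hy | hy) | hy
    · exact hSc hy
    · obtain ⟨s, hs, rfl⟩ := mem_image.mp hy
      exact hY s hs
    · rw [coe_singleton, Set.mem_singleton_iff] at hy
      rw [hy]; exact hR
  refine hodgeSpan_le_psp_of_shift hw hk hc2 hcen hwc h1 S hS (fun Φ => ?_) (fun s hs => ?_) ?_
  · obtain ⟨l, hl, r, hr, e⟩ := Submodule.mem_sup.mp (hcov Φ)
    exact Submodule.mem_sup.mpr ⟨l, hmono hl, r, hr, e⟩
  · refine Submodule.mem_sup_right (mem_span_translates_of_mem c S ?_)
    rw [hSdef]; exact mem_union_left _ (mem_union_right _ (mem_image_of_mem _ hs))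
  · refine Submodule.mem_sup_right (mem_span_translates_of_mem c S ?_)
    rw [hSdef]; exact mem_union_right _ (mem_singleton_self _)

/-- **THE REPAIRED TARGET IS COMPLETE** (the converse of part XIʼs obstruction): modulo `hodgeSpan`, every CM type is an INTEGRAL combination of arc
types and bottom flips — `[Φ] − [T_0] − Σ_{t ∈ T_0∖Φ} ([T_{w t}^{(t)}] − [T_{w t}])` has type sum `0`.  So (RED) of part XII holds for `L = hodgeSpan` with
exponent `0`; the arc block alone misses it by the fibre obstruction. [folklore] -/
theorem single_sub_mem_hodgeSpan_of_bottomFlips (hw : ∀ P Q : G, w (P * Q) = w P + w Q) (hk : 1 ≤ k) (hc2 : c * c = 1)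
    (hcen : ∀ x : G, x * c = c * x) (hwc : w c ≠ 0) (Φ : CMF G c) :
    Finsupp.single Φ (1 : ℤ) - Finsupp.single (arcType hw hk hc2 hwc 0) 1 -
      (∑ t ∈ (arcType hw hk hc2 hwc 0).1 \ Φ.1,
        (Finsupp.single (oflipCM c hc2 t (arcType hw hk hc2 hwc (w t))) (1 : ℤ) - Finsupp.single (arcType hw hk hc2 hwc (w t)) 1)) ∈
      hodgeSpan c hc2 := by
  have hc1 : c ≠ 1 := c_ne_one hw hwc
  -- the normal form `[Φ] − [T_0] − Σ_{t ∈ T_0∖Φ} ([T_0^{(t)}] − [T_0])` is a sum of faces, and each summand differs from the bottom-flip summand by `Y(t)`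
  have hlin := single_sub_normalForm_mem_span_local hc2 (arcType hw hk hc2 hwc 0) ((arcType hw hk hc2 hwc 0).1 \ Φ.1) Φ subset_rfl
  have hY : ∀ t ∈ (arcType hw hk hc2 hwc 0).1 \ Φ.1,
      (Finsupp.single (oflipCM c hc2 t (arcType hw hk hc2 hwc 0)) (1 : ℤ) - Finsupp.single (arcType hw hk hc2 hwc 0) 1) -
        (Finsupp.single (oflipCM c hc2 t (arcType hw hk hc2 hwc (w t))) (1 : ℤ) - Finsupp.single (arcType hw hk hc2 hwc (w t)) 1) ∈
          hodgeSpan c hc2 := by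
    intro t ht
    have htT : t ∈ (arcType hw hk hc2 hwc 0).1 := (mem_sdiff.mp ht).1
    have ht' : t ∈ (arcType hw hk hc2 hwc (w t)).1 := by rw [mem_arcType, sub_self, ZMod.val_zero]; exact Nat.two_pow_pos _
    refine mem_hodgeSpan_of_forall_typeSum_eq c hc2 hc1 hcen (k := 0) fun x => ?_
    simp only [map_sub, Pi.sub_apply, typeSum_single]
    rw [indG_oflipCM_eq hc2 hc1 _ htT, indG_oflipCM_eq hc2 hc1 _ ht']
    ring
  have e : Finsupp.single Φ (1 : ℤ) - Finsupp.single (arcType hw hk hc2 hwc 0) 1 -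
      (∑ t ∈ (arcType hw hk hc2 hwc 0).1 \ Φ.1,
        (Finsupp.single (oflipCM c hc2 t (arcType hw hk hc2 hwc (w t))) (1 : ℤ) - Finsupp.single (arcType hw hk hc2 hwc (w t)) 1)) =
      (Finsupp.single Φ (1 : ℤ) - ((∑ t ∈ (arcType hw hk hc2 hwc 0).1 \ Φ.1,
        (Finsupp.single (oflipCM c hc2 t (arcType hw hk hc2 hwc 0)) (1 : ℤ) - Finsupp.single (arcType hw hk hc2 hwc 0) 1)) +
          Finsupp.single (arcType hw hk hc2 hwc 0) 1)) +
      ∑ t ∈ (arcType hw hk hc2 hwc 0).1 \ Φ.1,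
        ((Finsupp.single (oflipCM c hc2 t (arcType hw hk hc2 hwc 0)) (1 : ℤ) - Finsupp.single (arcType hw hk hc2 hwc 0) 1) -
          (Finsupp.single (oflipCM c hc2 t (arcType hw hk hc2 hwc (w t))) (1 : ℤ) - Finsupp.single (arcType hw hk hc2 hwc (w t)) 1)) := by
    simp only [Finset.sum_sub_distrib]; abel
  rw [e]
  refine Submodule.add_mem _ (Submodule.mem_sup_left (Submodule.span_mono ?_ hlin)) (Submodule.sum_mem _ hY)
  rintro _ ⟨Φ', s, s', -, hs, hs', hss', rfl⟩
  refine ⟨Φ', s, s', ?_, rfl⟩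
  rw [mem_orb]
  rintro (h | h)
  · exact hss' h.symm
  · exact ((arcType hw hk hc2 hwc 0).2 s).mp (mem_sdiff.mp hs).1 (h ▸ (mem_sdiff.mp hs').1)

/-! ## §3 THE ARC-SHIFT META THEOREM -/

/-- **THE ARC-SHIFT META THEOREM** (ANY finite `G`, `c` central, `w : G ↠ ℤ/2ᵏ` additive with `w c ≠ 0`, `k ≥ 1`).  A family `S₀` of rank-four faces with
`|S₀| ≤ φ₂(G, c)` whose `ℤ[G]`-span together with the pairs (cov) reduces every type integrally to the types of potential `≤ 1` w.r.t. the arc block,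
(shift) contains the arc-shift relations `[T_0^{(s)}] − [T_0] − [T_{w s}^{(s)}] + [T_{w s}]` (`s ∈ T_0`) and (fib) contains the fibre-sum relation
`Σ_{w s = 0} [T_0^{(s)}] − [T_1] − (|ker w| − 1)·[T_0]` has EXACTLY `φ₂(G, c)` members, and **`μ(G, c) = φ₂(G, c)`**. [folklore] -/
theorem isLeast_card_gfaces_generate_of_shift [Fintype (CMF G c)] (hw : ∀ P Q : G, w (P * Q) = w P + w Q) (hk : 1 ≤ k) (hc2 : c * c = 1)
    (hcen : ∀ x : G, x * c = c * x) (hwc : w c ≠ 0) (h1 : ∃ g₁ : G, w g₁ = 1) (S₀ : Finset (CMF G c →₀ ℤ))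
    (hS₀ : (↑S₀ : Set (CMF G c →₀ ℤ)) ⊆ gfaceSet G c hc2) (hcard : S₀.card ≤ fibreTwo c hc2)
    (hcov : ∀ Φ : CMF G c, Finsupp.single Φ (1 : ℤ) ∈
      (Submodule.span ℤ (pairSet c) ⊔ Submodule.span ℤ (translates c S₀)) ⊔
        Submodule.span ℤ ((fun Ψ => Finsupp.single Ψ (1 : ℤ)) '' {Ψ : CMF G c | bpot c (arcType hw hk hc2 hwc 0) Ψ ≤ 1}))
    (hshift : ∀ s ∈ (arcType hw hk hc2 hwc 0).1,
      Finsupp.single (oflipCM c hc2 s (arcType hw hk hc2 hwc 0)) (1 : ℤ) - Finsupp.single (arcType hw hk hc2 hwc 0) 1 -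
        Finsupp.single (oflipCM c hc2 s (arcType hw hk hc2 hwc (w s))) 1 + Finsupp.single (arcType hw hk hc2 hwc (w s)) 1 ∈
          Submodule.span ℤ (pairSet c) ⊔ Submodule.span ℤ (translates c S₀))
    (hfib : (∑ s ∈ univ.filter (fun s => w s = 0), Finsupp.single (oflipCM c hc2 s (arcType hw hk hc2 hwc 0)) (1 : ℤ)) -
      Finsupp.single (arcType hw hk hc2 hwc 1) (1 : ℤ) -
        (((univ.filter fun s => w s = 0).card : ℤ) - 1) • Finsupp.single (arcType hw hk hc2 hwc 0) (1 : ℤ) ∈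
          Submodule.span ℤ (pairSet c) ⊔ Submodule.span ℤ (translates c S₀)) :
    S₀.card = fibreTwo c hc2 ∧
    IsLeast {n : ℕ | ∃ S : Finset (CMF G c →₀ ℤ), (↑S ⊆ gfaceSet G c hc2) ∧ S.card = n ∧
      hodgeSpan c hc2 ≤ Submodule.span ℤ (pairSet c) ⊔ Submodule.span ℤ (translates c S)} (fibreTwo c hc2) := by
  have hgen := hodgeSpan_le_psp_of_shift hw hk hc2 hcen hwc h1 S₀ (hS₀.trans (gfaceSet_subset_hodgeSpan c hc2)) hcov hshift hfib
  have hge : fibreTwo c hc2 ≤ S₀.card :=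
    fibreTwo_le_card_of_faces c hc2 hcen S₀ hS₀ fun y hy => hgen (gfaceSet_subset_hodgeSpan c hc2 hy)
  have hcardEq : S₀.card = fibreTwo c hc2 := le_antisymm hcard hge
  refine ⟨hcardEq, ⟨S₀, hS₀, hcardEq, hgen⟩, ?_⟩
  rintro n ⟨S, hS, rfl, hgen'⟩
  exact fibreTwo_le_card_of_faces c hc2 hcen S hS fun y hy => hgen' (gfaceSet_subset_hodgeSpan c hc2 hy)

/-- **THE ARC-SHIFT META THEOREM, fibre-independent form**: the same with `|S₀| ≤ φ₂` replaced by fibre-independence of `S₀` (which bounds `|S₀|` by `φ₂`,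
`Splitting.card_le_fibreTwo_of_fibreIndep`). [folklore] -/
theorem isLeast_card_gfaces_generate_of_shift_fibreIndep [Fintype (CMF G c)] (hw : ∀ P Q : G, w (P * Q) = w P + w Q) (hk : 1 ≤ k)
    (hc2 : c * c = 1) (hcen : ∀ x : G, x * c = c * x) (hwc : w c ≠ 0) (h1 : ∃ g₁ : G, w g₁ = 1) (S₀ : Finset (CMF G c →₀ ℤ))
    (hS₀ : (↑S₀ : Set (CMF G c →₀ ℤ)) ⊆ gfaceSet G c hc2)
    (hli : LinearIndepOn (ZMod 2) (fun f : CMF G c →₀ ℤ => (rad2 c hc2).mkQ (red c f)) ↑S₀)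
    (hcov : ∀ Φ : CMF G c, Finsupp.single Φ (1 : ℤ) ∈
      (Submodule.span ℤ (pairSet c) ⊔ Submodule.span ℤ (translates c S₀)) ⊔
        Submodule.span ℤ ((fun Ψ => Finsupp.single Ψ (1 : ℤ)) '' {Ψ : CMF G c | bpot c (arcType hw hk hc2 hwc 0) Ψ ≤ 1}))
    (hshift : ∀ s ∈ (arcType hw hk hc2 hwc 0).1,
      Finsupp.single (oflipCM c hc2 s (arcType hw hk hc2 hwc 0)) (1 : ℤ) - Finsupp.single (arcType hw hk hc2 hwc 0) 1 -
        Finsupp.single (oflipCM c hc2 s (arcType hw hk hc2 hwc (w s))) 1 + Finsupp.single (arcType hw hk hc2 hwc (w s)) 1 ∈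
          Submodule.span ℤ (pairSet c) ⊔ Submodule.span ℤ (translates c S₀))
    (hfib : (∑ s ∈ univ.filter (fun s => w s = 0), Finsupp.single (oflipCM c hc2 s (arcType hw hk hc2 hwc 0)) (1 : ℤ)) -
      Finsupp.single (arcType hw hk hc2 hwc 1) (1 : ℤ) -
        (((univ.filter fun s => w s = 0).card : ℤ) - 1) • Finsupp.single (arcType hw hk hc2 hwc 0) (1 : ℤ) ∈
          Submodule.span ℤ (pairSet c) ⊔ Submodule.span ℤ (translates c S₀)) :
    S₀.card = fibreTwo c hc2 ∧
    IsLeast {n : ℕ | ∃ S : Finset (CMF G c →₀ ℤ), (↑S ⊆ gfaceSet G c hc2) ∧ S.card = n ∧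
      hodgeSpan c hc2 ≤ Submodule.span ℤ (pairSet c) ⊔ Submodule.span ℤ (translates c S)} (fibreTwo c hc2) :=
  isLeast_card_gfaces_generate_of_shift hw hk hc2 hcen hwc h1 S₀ hS₀ (card_le_fibreTwo_of_fibreIndep c hc2 S₀ hS₀ hli) hcov hshift hfib

/-- **The walk form**: (shift) and (cov) together with the bottom-walk faces in `ℤ⟨pairs⟩ + ℤ[G]·S₀` (part XIV supplies (fib)) give `μ(G, c) = φ₂(G, c)`. [folklore] -/
theorem isLeast_card_gfaces_generate_of_shift_of_walkFaces_le [Fintype (CMF G c)] (hw : ∀ P Q : G, w (P * Q) = w P + w Q) (hk : 1 ≤ k)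
    (hc2 : c * c = 1) (hcen : ∀ x : G, x * c = c * x) (hwc : w c ≠ 0) (h1 : ∃ g₁ : G, w g₁ = 1) (S₀ : Finset (CMF G c →₀ ℤ))
    (hS₀ : (↑S₀ : Set (CMF G c →₀ ℤ)) ⊆ gfaceSet G c hc2) (hcard : S₀.card ≤ fibreTwo c hc2)
    (hcov : ∀ Φ : CMF G c, Finsupp.single Φ (1 : ℤ) ∈
      (Submodule.span ℤ (pairSet c) ⊔ Submodule.span ℤ (translates c S₀)) ⊔
        Submodule.span ℤ ((fun Ψ => Finsupp.single Ψ (1 : ℤ)) '' {Ψ : CMF G c | bpot c (arcType hw hk hc2 hwc 0) Ψ ≤ 1}))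
    (hshift : ∀ s ∈ (arcType hw hk hc2 hwc 0).1,
      Finsupp.single (oflipCM c hc2 s (arcType hw hk hc2 hwc 0)) (1 : ℤ) - Finsupp.single (arcType hw hk hc2 hwc 0) 1 -
        Finsupp.single (oflipCM c hc2 s (arcType hw hk hc2 hwc (w s))) 1 + Finsupp.single (arcType hw hk hc2 hwc (w s)) 1 ∈
          Submodule.span ℤ (pairSet c) ⊔ Submodule.span ℤ (translates c S₀))
    (hW : Submodule.span ℤ {y : CMF G c →₀ ℤ | ∃ (Φ' : CMF G c) (s s' : G),
        (arcType hw hk hc2 hwc 0).1 \ Φ'.1 ⊆ (univ.filter fun s => w s = 0) ∧ s ∈ (arcType hw hk hc2 hwc 0).1 \ Φ'.1 ∧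
          s' ∈ (arcType hw hk hc2 hwc 0).1 \ Φ'.1 ∧ s ≠ s' ∧ y = gface c hc2 Φ' s s'} ≤
        Submodule.span ℤ (pairSet c) ⊔ Submodule.span ℤ (translates c S₀)) :
    S₀.card = fibreTwo c hc2 ∧
    IsLeast {n : ℕ | ∃ S : Finset (CMF G c →₀ ℤ), (↑S ⊆ gfaceSet G c hc2) ∧ S.card = n ∧
      hodgeSpan c hc2 ≤ Submodule.span ℤ (pairSet c) ⊔ Submodule.span ℤ (translates c S)} (fibreTwo c hc2) :=
  isLeast_card_gfaces_generate_of_shift hw hk hc2 hcen hwc h1 S₀ hS₀ hcard hcov hshift (hW (fibreSum_sub_mem_span_walkFaces hw hk hc2 hwc))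

end

end Summit.HodgeConjecture.CorCM.Census.CyclicCharacter
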